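import Literature.NumberTheory.Weil1964.ArchMetaplecticNonSplitting
import Literature.NumberTheory.Weil1964.ArchMetaplecticDoubleCoverHolds
import HarnessLib

/-!
# The metaplectic double cover does not split and `Mp₂(W)` is perfect — UNCONDITIONAL forms

Topic `NumberTheory/Weil1964`; namespace `Literature.NumberTheory.Weil1964`.  The theorems of
`Literature.NumberTheory.Weil1964.ArchMetaplecticNonSplitting` (Folland's Remark p. 161, Prop. (4.21) for the double
cover in algebraic form, Prop. (4.40); row B07-4 of the pub-hodgecm2 literature fan-out) were stated over the two records
R1 `Folland1989_Thm_4_37_ab σ`, R2 `Folland1989_Thm_4_37_c σ` of `ArchMetaplecticDoubleCover` as explicit hypotheses.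
Both records are now THEOREMS (`folland1989_Thm_4_37_ab_holds`, `folland1989_Thm_4_37_c_holds` of
`Literature.NumberTheory.Weil1964.ArchMetaplecticDoubleCoverHolds`, row B07-3), so this file records the hypothesis-free
statements, each a one-line instantiation (0 `def`, 0 named facts, net debt 0; `[Nonempty σ]` remains necessary — for
`σ = ∅` the cover `{±1} → 1` splits):

* `Mp₂.cover_not_split` — `pr : Mp₂(W) → Sp(W)` has no homomorphic section («the unique NONTRIVIAL two-fold cover»);
* `isMetaplectic_of_monoidHom`, `proj_not_split` — every multiplicative choice of implementers is metaplectic-normalised,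
  hence `Mp^𝓢(W) → Sp(W)` has NO homomorphic section: Folland's Remark p. 161 L16 «`ν` cannot be made into a
  single-valued representation of `Sp_c`» as a theorem about the tree's `MpS σ`;
* `Mp₂.monoidHom_eq_one_of_map_ε`, `Mp₂.monoidHom_eq_one`, `Mp₂.commutator_Mp₂_eq_top`, `Mp₂.monoidHom_circle_eq_one` —
  `Mp₂(W)` is perfect: no non-trivial homomorphism to any commutative group (Folland Prop. (4.21) for the double cover,
  continuity hypothesis removed);
* `Mp₂.monoidHom_eq_subtype`, `Mp₂.monoidHom_ext` — Folland Prop. (4.40) on the double cover: the only representation of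
  `Mp₂(W)` on `𝓢(ℝ^σ)` by unitary-restricting operators that is Heisenberg-covariant over `pr` is the tautological one.

## References

* [Folland1989] G. B. Folland, *Harmonic Analysis in Phase Space*, Annals of Mathematics Studies 122, Princeton UP 1989
  (held text `book:folland1989-harmonic-analysis-phase-space`): §4.1 Prop. (4.21) p0155; §4.2 Thm. (4.37) p0160, Remark
  p0161 L16, Prop. (4.39) p0161, p0162 L1–8, Prop. (4.40) p0162 L9–13.
* [Adams2007] J. Adams, *The theta correspondence over ℝ*, in: Harmonic Analysis, Group Representations, Automorphic
  Forms and Invariant Theory, World Scientific (2007) 1–39, §3.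
-/

set_option autoImplicit false

noncomputable section

namespace Literature.NumberTheory.Weil1964

open Literature.Analysis.SegalBargmann Literature.RepresentationTheory.HeisenbergGroup

variable {σ : Type*} [Fintype σ] [DecidableEq σ]

namespace MpS

/-- **The metaplectic double cover `pr : Mp₂(W) → Sp(W)` does not split** (`σ ≠ ∅`): there is no homomorphism
`s : Sp(W) → Mp₂(W)` with `pr ∘ s = id`. [cite: Folland1989, §4.2 Thm. (4.37), Remark p. 161 L16; Adams2007, §3] -/
theorem Mp₂.cover_not_split [Nonempty σ] :
    ¬ ∃ s : symplecticGroup (polar (dotPairing σ)) →* Mp₂ σ, ∀ g, Mp₂.pr (s g) = g :=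
  Mp₂.not_exists_section (folland1989_Thm_4_37_ab_holds σ) (folland1989_Thm_4_37_c_holds σ)

/-- **Every multiplicative choice of implementers is metaplectic-normalised**: if `μ : Sp(W) →* Mp^𝓢(W)` is a
homomorphism with `proj ∘ μ = id`, then `C(μ g)² det P(g) = 1` for every `g` (Folland's uniqueness argument, p. 161 L14,
with R1/R2 now theorems). [cite: Folland1989, §4.2 Thm. (4.37), p. 161 L12–16, Prop. (4.21)] -/
theorem isMetaplectic_of_monoidHom (μ : symplecticGroup (polar (dotPairing σ)) →* MpS σ) (hμ : ∀ g, proj (μ g) = g)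
    (g : symplecticGroup (polar (dotPairing σ))) : IsMetaplectic (μ g) :=
  isMetaplectic_of_hom (folland1989_Thm_4_37_ab_holds σ) (folland1989_Thm_4_37_c_holds σ) μ hμ g

/-- **Folland's Remark p. 161, as a theorem: the metaplectic representation cannot be made single-valued** (`σ ≠ ∅`) —
there is NO homomorphism `μ : Sp(W) →* Mp^𝓢(W)` with `proj ∘ μ = id`, whatever the phases: the `S¹`-extension
`Mp^𝓢(W) → Sp(W)` of `ArchMetaplecticExtension` does not split. [cite: Folland1989, §4.2 Thm. (4.37), Remark p. 161 L16] -/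
theorem proj_not_split [Nonempty σ] :
    ¬ ∃ μ : symplecticGroup (polar (dotPairing σ)) →* MpS σ, ∀ g, proj (μ g) = g :=
  not_exists_hom_section (folland1989_Thm_4_37_ab_holds σ) (folland1989_Thm_4_37_c_holds σ)

/-- **Descent**: a homomorphism of `Mp₂(W)` to a commutative group that kills `ε = −1` is trivial.
[cite: Folland1989, §4.1 Prop. (4.21), §4.2 Thm. (4.37)] -/
theorem Mp₂.monoidHom_eq_one_of_map_ε {A : Type*} [CommGroup A] (χ : Mp₂ σ →* A) (hε : χ Mp₂.ε = 1) : χ = 1 :=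
  Mp₂.hom_eq_one_of_map_ε (folland1989_Thm_4_37_ab_holds σ) (folland1989_Thm_4_37_c_holds σ) χ hε

/-- **`Mp₂(W)` admits no non-trivial homomorphism to a commutative group** (`σ ≠ ∅`) — Folland Prop. (4.21) for the
double cover, any commutative target, no continuity assumption. [cite: Folland1989, §4.1 Prop. (4.21), §4.2 Prop. (4.40)] -/
theorem Mp₂.monoidHom_eq_one [Nonempty σ] {A : Type*} [CommGroup A] (χ : Mp₂ σ →* A) : χ = 1 :=
  Mp₂.hom_eq_one (folland1989_Thm_4_37_ab_holds σ) (folland1989_Thm_4_37_c_holds σ) χ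

/-- **`Hom(Mp₂(W), S¹) = 1`** (`σ ≠ ∅`) — the circle-valued case, Folland's wording. [cite: Folland1989, §4.1 Prop. (4.21), §4.2 Remark p. 161 L16] -/
theorem Mp₂.monoidHom_circle_eq_one [Nonempty σ] (χ : Mp₂ σ →* Circle) : χ = 1 :=
  Mp₂.monoidHom_eq_one χ

/-- **`Mp₂(W)` is perfect**: its commutator subgroup is everything (`σ ≠ ∅`).
[cite: Folland1989, §4.1 Prop. (4.20)–(4.21), §4.2 Prop. (4.40)] -/
theorem Mp₂.commutator_Mp₂_eq_top [Nonempty σ] : commutator (Mp₂ σ) = ⊤ :=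
  Mp₂.commutator_eq_top (folland1989_Thm_4_37_ab_holds σ) (folland1989_Thm_4_37_c_holds σ)

/-- **Folland Prop. (4.40) on the double cover** (`σ ≠ ∅`): a homomorphism `μ₁ : Mp₂(W) →* Mp^𝓢(W)` lying over `pr` — a
representation of `Mp₂(W)` on `𝓢(ℝ^σ)` by restrictions of unitary operators of `L²(ℝ^σ)`, Heisenberg-covariant over
`pr(x)` — IS the inclusion `x ↦ x`. [cite: Folland1989, §4.2 Prop. (4.40) p. 162 L9–13, Prop. (4.21)] -/
theorem Mp₂.monoidHom_eq_subtype [Nonempty σ] (μ₁ : Mp₂ σ →* MpS σ) (hμ : ∀ x, proj (μ₁ x) = Mp₂.pr x) :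
    μ₁ = (Mp₂ σ).subtype :=
  Mp₂.eq_subtype_of_proj_eq (folland1989_Thm_4_37_ab_holds σ) (folland1989_Thm_4_37_c_holds σ) μ₁ hμ

/-- **Corollary: two representations of `Mp₂(W)` on `𝓢(ℝ^σ)` lying over `pr` coincide** (`σ ≠ ∅`).
[cite: Folland1989, §4.2 Prop. (4.40) p. 162 L9–13] -/
theorem Mp₂.monoidHom_ext [Nonempty σ] (μ₁ μ₂ : Mp₂ σ →* MpS σ) (hμ₁ : ∀ x, proj (μ₁ x) = Mp₂.pr x)
    (hμ₂ : ∀ x, proj (μ₂ x) = Mp₂.pr x) : μ₁ = μ₂ :=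
  Mp₂.hom_ext_of_proj_eq (folland1989_Thm_4_37_ab_holds σ) (folland1989_Thm_4_37_c_holds σ) μ₁ μ₂ hμ₁ hμ₂

end MpS

end Literature.NumberTheory.Weil1964

end
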